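import Literature.NumberTheory.Automorphic.ClozelAlgebraicityComplexConjProofs
import Literature.NumberTheory.Automorphic.ClozelAlgebraicityRatFieldProofs
import Literature.NumberTheory.Automorphic.AutomorphicRepLieActionGL
import Literature.NumberTheory.Automorphic.HarishChandraGLConj
import HarnessLib

/-!
# Clozel's algebraicity fact at `σ = c`: the infinity type of the complex conjugate (proofs)

Archimedean companion of `ClozelAlgebraicityComplexConjProofs`. For an automorphic representation
`π = W / W'` of `GL_n(𝔸_K)` (Borel–Jacquet datum) with complex conjugate `π̄ = W̄ / W̄'`
(`AutomorphicRepData.conj`), the real Lie algebra `𝔤𝔩_n(K_∞)` acts on `π̄` through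
`X φ̄ = \overline{X φ}`, i.e. `π̄` is the conjugate module of `π` along the conjugate-linear
bijection `[φ] ↦ [φ̄]` (`AutomorphicRepData.quotConjEquiv`, `lieRep_conj_quotConjEquiv`). Hence, by
`HasHCParameter.of_conjSemilinear` (`HarishChandraGLConj`) place by place:

* `AutomorphicRepData.HasArchParameter.conj` — if `π` has archimedean parameter `χ` then `π̄` has
  archimedean parameter `ι ↦ \overline{χ(c ∘ ι)}` (conjugate entries at the conjugate embedding);
* `AutomorphicRepData.HasInfinityType.conj` — an infinity type `T` of `π` gives the infinity type
  `T.conjType : ι ↦ {(b̄, ā) : (a, b) ∈ T ι}` of `π̄` (the character `z ↦ z^a z̄^b` of `ℂˣ`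
  conjugates to `z ↦ z^{b̄} z̄^{ā}`); for a `C`-algebraic `T` (real exponents) this is Clozel's
  `^cT = T.autConj c : ι ↦ T(c ∘ ι)` (`InfinityType.conjType_eq_autConj`);
* **`CuspidalAutomorphicRepData.exists_isAutConjugate_conj_hasInfinityType`** — clause (ii) of
  `Clozel1990_regularAlgebraic` for `σ = c`, unconditionally and in exactly the vendored shape:
  every cuspidal `π` has a cuspidal `c`-conjugate `π'` at almost all places (`π' = π̄`,
  `ClozelAlgebraicityComplexConjProofs`) such that every regular algebraic infinity type `T` of `π`
  yields an infinity type `T'` of `π'` with the `a`-multisets of `^cT` (indeed `T' = ^cT`).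
  (Clozel 1990, Thm. 3.13 with `σ = c`: "`^σπ_∞` a pour type `^σ(p, q)`"; Patrikis 2019, §3.2.)

Theorems plus two small definitions (`ArchWeight.conjSwap`, `InfinityType.conjType`, the
conjugate infinity type, and the quotient bijection `quotConjEquiv`); no named facts, no `sorry`.

## References

* L. Clozel, *Motifs et formes automorphes*, in Automorphic forms, Shimura varieties, and
  L-functions I (1990), §3.1, §3.3, Thm. 3.13 [Clozel1990].
* S. Patrikis, *Variations on a theorem of Tate*, Mem. AMS 258 (2019), §3.2 [Patrikis2019].
* A. W. Knapp, *Lie Groups Beyond an Introduction* (2002), Thm. 5.44 [Knapp2002].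
* K. Buzzard, T. Gee (2014), §3.1 [BuzzardGee2014].
-/

-- Mathlib idiom (Mathlib/Algebra/Lie/OfAssociative.lean): the commutator bracket on matrices
attribute [local instance 100] LieRing.ofAssociativeRing

noncomputable section

open scoped MatrixGroups Matrix Classical
open NumberField NumberField.InfinitePlace NumberField.mixedEmbedding IsDedekindDomain

namespace Literature.NumberTheory.Automorphic

/-! ### The conjugate infinity type -/

namespace ArchWeight

/-- The **conjugate archimedean weight** `(a, b) ↦ (b̄, ā)`: the conjugate
`z ↦ \overline{z^a z̄^b} = z^{b̄} z̄^{ā}` of the character `z ↦ z^a z̄^b` of `ℂˣ`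
(`b̄ - ā = -\overline{(a - b)} ∈ ℤ`). Clozel 1990, §3.3; Buzzard–Gee 2014, §3.1. [folklore] -/
def conjSwap (p : ArchWeight) : ArchWeight where
  a := starRingEnd ℂ p.b
  b := starRingEnd ℂ p.a
  exists_int_sub := by
    obtain ⟨m, hm⟩ := p.exists_int_sub
    refine ⟨-m, ?_⟩
    rw [← map_sub, ← neg_sub, map_neg, hm, map_intCast, Int.cast_neg]

/-- The `a`-exponent of the conjugate weight is `b̄`. [folklore] -/
@[simp] theorem conjSwap_a (p : ArchWeight) : p.conjSwap.a = starRingEnd ℂ p.b := rfl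

/-- The `b`-exponent of the conjugate weight is `ā`. [folklore] -/
@[simp] theorem conjSwap_b (p : ArchWeight) : p.conjSwap.b = starRingEnd ℂ p.a := rfl

/-- `conjSwap` commutes with `swap`. [folklore] -/
theorem conjSwap_swap (p : ArchWeight) : p.swap.conjSwap = p.conjSwap.swap := rfl

/-- A weight with real exponents is conjugated to its swap: `(a, b) ↦ (b, a)`. [folklore] -/
theorem conjSwap_eq_swap {p : ArchWeight} (ha : starRingEnd ℂ p.a = p.a) (hb : starRingEnd ℂ p.b = p.b) :
    p.conjSwap = p.swap :=
  ArchWeight.ext hb ha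

end ArchWeight

namespace InfinityType

variable {K : Type*} [Field K] {n : ℕ}

/-- The **conjugate infinity type** `T̄ : ι ↦ {(b̄, ā) : (a, b) ∈ T ι}` — the infinity type of the
complex conjugate representation `π̄` (`AutomorphicRepData.HasInfinityType.conj`).
Clozel 1990, §3.1 and §3.3. [cite: Clozel1990, §3.3] -/
def conjType (T : InfinityType K n) : InfinityType K n :=
  fun ι ↦ (T ι).map ArchWeight.conjSwap

/-- Unfolding `conjType`. [folklore] -/
@[simp] theorem conjType_apply (T : InfinityType K n) (ι : K →+* ℂ) :
    T.conjType ι = (T ι).map ArchWeight.conjSwap := rfl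

/-- The conjugate of a well-formed infinity type is well formed. [folklore] -/
theorem IsWellFormed.conjType {T : InfinityType K n} (h : T.IsWellFormed) : T.conjType.IsWellFormed := by
  refine ⟨fun ι ↦ by rw [conjType_apply, Multiset.card_map, h.1 ι], fun ι ↦ ?_⟩
  rw [conjType_apply, conjType_apply, h.2 ι, Multiset.map_map, Multiset.map_map]
  rfl

/-- The `a`-multisets of the conjugate type: `{a of T̄ at ι} = \overline{\{a of T at c ∘ ι\}}` for
well-formed `T` (the `b`'s at `ι` are the `a`'s at `c ∘ ι`). [folklore] -/
theorem conjType_map_a {T : InfinityType K n} (h : T.IsWellFormed) (ι : K →+* ℂ) :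
    (T.conjType ι).map ArchWeight.a =
      ((T (ComplexEmbedding.conjugate ι)).map ArchWeight.a).map (starRingEnd ℂ) := by
  rw [conjType_apply, h.2 ι, Multiset.map_map, Multiset.map_map, Multiset.map_map]
  rfl

/-- `^cT`: conjugating by complex conjugation re-indexes an infinity type by `ι ↦ c ∘ ι`. [folklore] -/
theorem autConj_conj_apply (T : InfinityType K n) (ι : K →+* ℂ) :
    T.autConj (Complex.conjAe.restrictScalars ℚ) ι = T (ComplexEmbedding.conjugate ι) := by
  rw [autConj_apply]
  congr 1

/-- **For a `C`-algebraic infinity type the conjugate type is Clozel's `^cT`**: all exponents lie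
in `(n-1)/2 + ℤ ⊂ ℝ`, so `(b̄, ā) = (b, a)` and `T̄ ι = swap (T ι) = T (c ∘ ι) = (^cT) ι`.
Clozel 1990, Thm. 3.13 (`σ = c`). [cite: Clozel1990, Thm. 3.13 (σ = c)] -/
theorem conjType_eq_autConj {T : InfinityType K n} (hwf : T.IsWellFormed) (hC : T.IsCAlgebraic) :
    T.conjType = T.autConj (Complex.conjAe.restrictScalars ℚ) := by
  funext ι
  rw [autConj_conj_apply, hwf.2 ι, conjType_apply]
  refine Multiset.map_congr rfl fun p hp ↦ ?_
  obtain ⟨k, l, hk, hl⟩ := hC ι p hp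
  have hr : ∀ (m : ℤ), starRingEnd ℂ ((m : ℂ) + ((n : ℂ) - 1) / 2) = (m : ℂ) + ((n : ℂ) - 1) / 2 :=
    fun m ↦ by simp only [map_add, map_intCast, map_div₀, map_sub, map_natCast, map_one, map_ofNat]
  exact ArchWeight.conjSwap_eq_swap (by rw [hk, hr]) (by rw [hl, hr])

end InfinityType

/-! ### `π̄` is the conjugate module of `π` -/

namespace AutomorphicRepData

variable {n : ℕ} {K : Type} [Field K] [NumberField K] {hcpt : isCompact_glFiniteIntegralLevel n K}
  (π : AutomorphicRepData (AutomorphyDatum.gl n K hcpt))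

/-- Conjugation `φ ↦ φ̄` as a conjugate-linear bijection `W ≃ W̄`. [folklore] -/
def conjEquivW : π.W ≃ₛₗ[starRingEnd ℂ] π.conj.W where
  toFun φ := ⟨star (φ : (AdelicGroupData.gl n K).Adelic → ℂ), (star_mem_conjSubmodule_iff _ _).mpr φ.2⟩
  invFun ψ := ⟨star (ψ : (AdelicGroupData.gl n K).Adelic → ℂ), ψ.2⟩
  map_add' _ _ := Subtype.ext (star_add _ _)
  map_smul' _ _ := Subtype.ext (star_smul _ _)
  left_inv _ := Subtype.ext (star_star _)
  right_inv _ := Subtype.ext (star_star _)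

/-- `(conjEquivW φ : function) = φ̄`. [folklore] -/
@[simp] theorem coe_conjEquivW (φ : π.W) :
    ((π.conjEquivW φ : π.conj.W) : (AdelicGroupData.gl n K).Adelic → ℂ) =
      star (φ : (AdelicGroupData.gl n K).Adelic → ℂ) := rfl

/-- `W'` corresponds to `W̄'` under `φ ↦ φ̄`. [folklore] -/
theorem kerQuot_le_comap_conjEquivW :
    π.kerQuot ≤ π.conj.kerQuot.comap (π.conjEquivW : π.W →ₛₗ[starRingEnd ℂ] π.conj.W) := by
  intro φ hφ
  change star (star (φ : (AdelicGroupData.gl n K).Adelic → ℂ)) ∈ π.W'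
  rw [star_star]
  exact hφ

/-- `W̄'` corresponds to `W'` under `ψ ↦ ψ̄`. [folklore] -/
theorem kerQuot_conj_le_comap_conjEquivW_symm :
    π.conj.kerQuot ≤ π.kerQuot.comap (π.conjEquivW.symm : π.conj.W →ₛₗ[starRingEnd ℂ] π.W) :=
  fun _ hψ ↦ hψ

/-- **`[φ] ↦ [φ̄]`: the conjugate-linear bijection `W / W' ≃ W̄ / W̄'`.** [folklore] -/
def quotConjEquiv : π.Quot ≃ₛₗ[starRingEnd ℂ] π.conj.Quot :=
  LinearEquiv.ofLinear
    (π.kerQuot.mapQ π.conj.kerQuot (π.conjEquivW : π.W →ₛₗ[starRingEnd ℂ] π.conj.W)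
      π.kerQuot_le_comap_conjEquivW)
    (π.conj.kerQuot.mapQ π.kerQuot (π.conjEquivW.symm : π.conj.W →ₛₗ[starRingEnd ℂ] π.W)
      π.kerQuot_conj_le_comap_conjEquivW_symm)
    (by
      refine Submodule.linearMap_qext _ (LinearMap.ext fun ψ ↦ ?_)
      simp only [LinearMap.comp_apply, Submodule.mkQ_apply, Submodule.mapQ_apply,
        LinearEquiv.coe_coe, LinearEquiv.apply_symm_apply, LinearMap.id_apply])
    (by
      refine Submodule.linearMap_qext _ (LinearMap.ext fun φ ↦ ?_)
      simp only [LinearMap.comp_apply, Submodule.mkQ_apply, Submodule.mapQ_apply,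
        LinearEquiv.coe_coe, LinearEquiv.symm_apply_apply, LinearMap.id_apply])

/-- `quotConjEquiv [φ] = [φ̄]`. [folklore] -/
theorem quotConjEquiv_mkQ (φ : π.W) : π.quotConjEquiv (π.mkQ φ) = π.conj.mkQ (π.conjEquivW φ) :=
  rfl

/-- **`X [φ̄] = \overline{X [φ]}`: the Lie algebra action of `π̄` is the conjugate of that of `π`**
along `[φ] ↦ [φ̄]`, for any Lie action `ρ` of `π` (`lieDeriv_star`: `𝔤` is real).
Clozel 1990, §3.1; Borel–Jacquet 1979, §1.5 and 4.6. [cite: Clozel1990, §3.1] -/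
theorem lieRep_conj_quotConjEquiv {ρ : (AutomorphyDatum.gl n K hcpt).arch.lie →ₗ⁅ℝ⁆ Module.End ℂ π.Quot}
    (hρ : π.HasLieAction ρ) (X : (AutomorphyDatum.gl n K hcpt).arch.lie) (v : π.Quot) :
    π.conj.lieRep X (π.quotConjEquiv v) = π.quotConjEquiv (ρ X v) := by
  induction v using Submodule.Quotient.induction_on with
  | H φ =>
    have hmk : (Submodule.Quotient.mk φ : π.Quot) = π.mkQ φ := rfl
    rw [hmk, hρ X φ, quotConjEquiv_mkQ, quotConjEquiv_mkQ, π.conj.lieRep_mkQ]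
    congr 1
    exact Subtype.ext (lieDeriv_star (AutomorphyDatum.gl n K hcpt).ofArch X φ)

/-! ### The archimedean parameter and the infinity type of `π̄` -/

omit [NumberField K] in
/-- `c ∘ (τ ∘ σ) = (c ∘ τ) ∘ σ` for `τ : ℂ →ₐ[ℝ] ℂ` and an embedding `σ : K → ℂ`. [folklore] -/
theorem conjugate_algHom_comp (τ : ℂ →ₐ[ℝ] ℂ) (σ : K →+* ℂ) :
    ComplexEmbedding.conjugate (τ.toRingHom.comp σ) = (conjIdx τ).toRingHom.comp σ :=
  RingHom.ext fun _ ↦ rfl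

/-- **The archimedean parameter of `π̄`.** If `π` has archimedean (Harish-Chandra) parameter `χ`
(indexed by the embeddings `ι : K → ℂ`), then `π̄` has parameter `ι ↦ \overline{χ(c ∘ ι)}`:
place by place, `π̄` is the conjugate module of `π` (`lieRep_conj_quotConjEquiv`) and
`HasHCParameter.of_conjSemilinear` applies — at a real place `w` the index does not move
(`c ∘ σ_w = σ_w`), at a complex place the two copies `σ_w, σ̄_w` are exchanged.
Clozel 1990, §3.1, §3.3; Knapp 2002, Thm. 5.44. [cite: Clozel1990, §3.3] -/
theorem HasArchParameter.conj {χ : (K →+* ℂ) → Multiset ℂ} (h : π.HasArchParameter χ) :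
    π.conj.HasArchParameter fun ι ↦ (χ (ComplexEmbedding.conjugate ι)).map (starRingEnd ℂ) := by
  obtain ⟨ρ, hρ, hreal, hcx⟩ := h
  have hrel := π.lieRep_conj_quotConjEquiv hρ
  refine ⟨π.conj.lieRep, π.conj.hasLieAction_lieRep, fun w ↦ ?_, fun w ↦ ?_⟩
  · have hw : ComplexEmbedding.conjugate w.1.embedding = w.1.embedding :=
      ComplexEmbedding.isReal_iff.1 (isReal_iff.1 w.2)
    simp only [hw]
    exact HasHCParameter.of_conjSemilinear π.quotConjEquiv
      (fun Y v ↦ by simp only [LieHom.comp_apply]; exact hrel _ v) (hreal w)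
  · simp only [conjugate_algHom_comp]
    exact HasHCParameter.of_conjSemilinear π.quotConjEquiv
      (fun Y v ↦ by simp only [LieHom.comp_apply]; exact hrel _ v) (hcx w)

/-- **The infinity type of `π̄` is the conjugate type**: an infinity type `T` of `π` gives the
infinity type `T.conjType : ι ↦ {(b̄, ā)}` of `π̄` (well formed, with `a`-multisets
`\overline{\{a at c ∘ ι\}}` = the archimedean parameter of `π̄`). Clozel 1990, §3.3 and Thm. 3.13
(`σ = c`). [cite: Clozel1990, §3.3] -/
theorem HasInfinityType.conj {T : InfinityType K n} (hT : π.HasInfinityType T) :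
    π.conj.HasInfinityType T.conjType := by
  refine ⟨hT.1.conjType, ?_⟩
  have e : (fun ι ↦ (T.conjType ι).map ArchWeight.a) =
      fun ι ↦ ((T (ComplexEmbedding.conjugate ι)).map ArchWeight.a).map (starRingEnd ℂ) :=
    funext fun ι ↦ InfinityType.conjType_map_a hT.1 ι
  rw [e]
  exact HasArchParameter.conj π hT.2

/-- `π̄` is regular algebraic when `π` is (`^cT` of a regular algebraic `T` is regular algebraic).
Clozel 1990, Thm. 3.13. [cite: Clozel1990, Thm. 3.13] -/
theorem IsRegularAlgebraic.conj (h : π.IsRegularAlgebraic) : π.conj.IsRegularAlgebraic := by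
  obtain ⟨T, hT, hreg⟩ := h
  refine ⟨T.conjType, hT.conj, ?_⟩
  rw [InfinityType.conjType_eq_autConj hT.1 hreg.1]
  exact InfinityType.isRegularAlgebraic_of_map_a_eq_autConj hreg
    (InfinityType.conjType_eq_autConj hT.1 hreg.1 ▸ hT.1.conjType) _ fun _ ↦ rfl

end AutomorphicRepData

/-! ### Clause (ii) of Clozel's theorem at `σ = c` -/

variable {n : ℕ} {K : Type} [Field K] [NumberField K] {hcpt : isCompact_glFiniteIntegralLevel n K}

/-- **Clause (ii) of `Clozel1990_regularAlgebraic` for `σ = c`, unconditionally and in the vendored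
shape.** Every cuspidal automorphic representation `π` of `GL_n(𝔸_K)` has a cuspidal `π'` which is
the `c`-conjugate of `π` at almost all places (`IsAutConjugate c π π'`; `π' = π̄`,
`CuspidalAutomorphicRepData.conj`) and such that every regular algebraic infinity type `T` of `π`
yields an infinity type `T'` of `π'` with the `a`-multisets of `^cT = T.autConj c` — indeed
`T' = ^cT` itself (`HasInfinityType.conj`, `conjType_eq_autConj`). Clozel 1990, Thm. 3.13 with
`σ = c` (for general `σ` this is the deep content of the theorem; for `σ = c` conjugating the
forms suffices); Patrikis 2019, §3.2. [cite: Clozel1990, Thm. 3.13 (σ = c)] -/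
theorem CuspidalAutomorphicRepData.exists_isAutConjugate_conj_hasInfinityType
    (π : CuspidalAutomorphicRepData n K hcpt) :
    ∃ π' : CuspidalAutomorphicRepData n K hcpt,
      IsAutConjugate (Complex.conjAe.restrictScalars ℚ) π.1 π'.1 ∧
      ∀ T : InfinityType K n, π.1.HasInfinityType T → T.IsRegularAlgebraic →
        ∃ T' : InfinityType K n, π'.1.HasInfinityType T' ∧
          ∀ ι : K →+* ℂ, (T' ι).map ArchWeight.a =
            (T.autConj (Complex.conjAe.restrictScalars ℚ) ι).map ArchWeight.a :=
  ⟨π.conj, AutomorphicRepData.isAutConjugate_conj π.1, fun T hT hreg ↦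
    ⟨T.conjType, AutomorphicRepData.HasInfinityType.conj π.1 hT, fun ι ↦ by
      rw [InfinityType.conjType_eq_autConj hT.1 hreg.1]⟩⟩

end Literature.NumberTheory.Automorphic
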